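import Literature.Analysis.ODE.BarrierRates
import Literature.Analysis.ODE.RecessiveDominance
import HarnessLib

/-!
# Depth of the barrier basis from ONE good sub-interval, and the packaged depth-and-rates statement

Topic `Literature/Analysis/ODE` (namespace `Literature.Analysis.ODE`), continuing `BarrierRates.lean`
(reciprocal rates from one good sub-interval) with the cosh growth of `RecessiveDominance.lean`
(`mul_cosh_le_of_sq_le_coeff_right`). For the monotone two-end real basis `g, d` of `y″ = q y` on a
forbidden interval `[α, β]` (`q ≥ 0`, `g ≥ 1`, `g′ ≥ 0`, `g′(α) = 0`, `w₀ = g′(β)`), ONE sub-interval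
`[t₁, t₂] ⊆ [α, β]` with `q ≥ k² > 0` already gives an EXPONENTIAL Wronskian:

* `depth_of_good_interval` — `k·sinh(k(t₂ − t₁)) ≤ g′(β)` (`g(t₂) ≥ cosh(k(t₂ − t₁))·g(t₁) ≥ cosh`,
  `g′(t₂) ≥ k tanh(k(t₂ − t₁))·g(t₂)`, and `g′` is non-decreasing);
* `barrierBasis_depth_and_rates` — with `k(t₂ − t₁) ≥ 2`: `(k/4)·exp(k(t₂ − t₁)) ≤ w₀`,
  `d(α) ≤ ((t₁ − α) + 2/k)·w₀`, `g(β) ≤ ((β − t₂) + 2/k)·w₀` and `g(x)d(x) ≤ (4/k)·w₀` for all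
  `x ∈ [t₁, t₂]` — exactly the DEPTH `D ≤ w₀` and the three reciprocal RATES `R_α, R_β, R_m` consumed by
  `DeepBarrierKernelBound.kernel_le_of_deep_barrier`, for a barrier bounded by turning points, from the
  single datum "`q ≥ k²` on `[t₁, t₂]`".

One-interval real analysis; all proved. Used for Carter's radial equation in Breitenlohner–Freedman-stable
sectors (the good interval is the κ-free zone `r ∈ [r₊(1 + θ₁/8), r₊(1 + θ₁/4)]`), not here.

## References
* P. Hartman, *Ordinary Differential Equations* (SIAM Classics 38, 2002), Ch. XI Thm. 3.2, Ex. 3.1(a),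
  §6. Key `Hartman2002`. S. Agmon, *Lectures on exponential decay* (Princeton, 1982), Ch. 1 (the
  exponential weight `e^{∫√q}`). Folklore.
-/

noncomputable section

open Set

namespace Literature.Analysis.ODE

/-- **Depth from one good sub-interval.** Let `g″ = q g` on `[α, β]` with `q ≥ 0`, `g ≥ 1`, `g′ ≥ 0`
there, and let `α ≤ t₁ < t₂ ≤ β` with `q ≥ k²` on `[t₁, t₂]`, `k > 0`. Then
`k·sinh(k(t₂ − t₁)) ≤ g′(β)`. [folklore] -/
theorem depth_of_good_interval {g g' q : ℝ → ℝ} {α β t₁ t₂ k : ℝ}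
    (hg : ∀ s ∈ Icc α β, HasDerivAt g (g' s) s ∧ HasDerivAt g' (q s * g s) s)
    (hq0 : ∀ s ∈ Icc α β, 0 ≤ q s) (hg1 : ∀ s ∈ Icc α β, 1 ≤ g s) (hg'0 : ∀ s ∈ Icc α β, 0 ≤ g' s)
    (hαt : α ≤ t₁) (ht : t₁ < t₂) (htβ : t₂ ≤ β) (hk : 0 < k) (hqk : ∀ s ∈ Icc t₁ t₂, k ^ 2 ≤ q s) :
    k * Real.sinh (k * (t₂ - t₁)) ≤ g' β := by
  have hsub : Icc t₁ t₂ ⊆ Icc α β := Icc_subset_Icc hαt htβ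
  have hg0 : ∀ s ∈ Icc α β, 0 ≤ g s := fun s hs ↦ zero_le_one.trans (hg1 s hs)
  have ht₂ : t₂ ∈ Icc t₁ t₂ := right_mem_Icc.2 ht.le
  -- growth of `g` across `[t₁, t₂]`
  have h1 : g t₁ * Real.cosh (k * (t₂ - t₁)) ≤ g t₂ :=
    mul_cosh_le_of_sq_le_coeff_right (fun s hs ↦ hg s (hsub hs)) hqk (fun s hs ↦ hg0 s (hsub hs))
      (hg'0 t₁ ⟨hαt, ht.le.trans htβ⟩) t₂ ht₂
  have h1' : Real.cosh (k * (t₂ - t₁)) ≤ g t₂ := by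
    have hc : 0 ≤ Real.cosh (k * (t₂ - t₁)) := (Real.cosh_pos _).le
    calc Real.cosh (k * (t₂ - t₁)) = 1 * Real.cosh (k * (t₂ - t₁)) := (one_mul _).symm
      _ ≤ g t₁ * Real.cosh (k * (t₂ - t₁)) :=
          mul_le_mul_of_nonneg_right (hg1 t₁ ⟨hαt, ht.le.trans htβ⟩) hc
      _ ≤ g t₂ := h1
  -- rate of `g` at `t₂`
  have h2 : k * Real.tanh (k * (t₂ - t₁)) * g t₂ ≤ g' t₂ :=
    tanh_mul_le_deriv (fun s hs ↦ hg s (hsub hs)) hqk (fun s hs ↦ hg0 s (hsub hs))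
      (hg'0 t₁ ⟨hαt, ht.le.trans htβ⟩) t₂ ht₂
  -- `g′(t₂) ≤ g′(β)`
  have h3 : g' t₂ ≤ g' β :=
    deriv_monotoneOn_of_nonneg hg hq0 hg0 (hsub ht₂) (right_mem_Icc.2 (hαt.trans (ht.le.trans htβ)))
      htβ
  have ht0 : 0 ≤ k * Real.tanh (k * (t₂ - t₁)) :=
    (tanh_rate_pos_and_inv_le hk (sub_pos.2 ht)).1.le
  have e : k * Real.sinh (k * (t₂ - t₁)) = k * Real.tanh (k * (t₂ - t₁)) * Real.cosh (k * (t₂ - t₁)) := by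
    rw [Real.tanh_eq_sinh_div_cosh, mul_assoc, div_mul_cancel₀ _ (Real.cosh_pos _).ne']
  rw [e]
  calc k * Real.tanh (k * (t₂ - t₁)) * Real.cosh (k * (t₂ - t₁))
      ≤ k * Real.tanh (k * (t₂ - t₁)) * g t₂ := mul_le_mul_of_nonneg_left h1' ht0
    _ ≤ g' t₂ := h2
    _ ≤ g' β := h3

/-- **Depth and reciprocal rates of the barrier basis from one good sub-interval.** For the monotone
two-end basis `g, d` of `y″ = q y` on `[α, β]` (`q ≥ 0`; `g ≥ 1`, `g′ ≥ 0`, `d ≥ 1`, `d′ ≤ 0`;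
`g(α) = 1`, `g′(α) = 0`, `g′(β) = w₀`, Wronskian `g d′ − g′ d ≡ −w₀`) and a sub-interval
`α ≤ t₁ < t₂ ≤ β` with `q ≥ k²` (`k > 0`) on it and `k(t₂ − t₁) ≥ 2`:
`(k/4)·exp(k(t₂ − t₁)) ≤ w₀`, `d(α) ≤ ((t₁ − α) + 2/k)·w₀`, `g(β) ≤ ((β − t₂) + 2/k)·w₀`, and
`g(x)d(x) ≤ (4/k)·w₀` for every `x ∈ [t₁, t₂]`. [folklore] -/
theorem barrierBasis_depth_and_rates {q g g' d d' : ℝ → ℝ} {α β w₀ t₁ t₂ k : ℝ}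
    (hg : ∀ x ∈ Icc α β, HasDerivAt g (g' x) x ∧ HasDerivAt g' (q x * g x) x)
    (hd : ∀ x ∈ Icc α β, HasDerivAt d (d' x) x ∧ HasDerivAt d' (q x * d x) x)
    (hq0 : ∀ x ∈ Icc α β, 0 ≤ q x) (hgα : g α = 1) (hg'α : g' α = 0) (hg'β : g' β = w₀)
    (hsign : ∀ x ∈ Icc α β, 1 ≤ g x ∧ 0 ≤ g' x ∧ 1 ≤ d x ∧ d' x ≤ 0)
    (hW : ∀ x ∈ Icc α β, g x * d' x - g' x * d x = -w₀)
    (hαt : α ≤ t₁) (ht : t₁ < t₂) (htβ : t₂ ≤ β) (hk : 0 < k) (hqk : ∀ s ∈ Icc t₁ t₂, k ^ 2 ≤ q s)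
    (hkℓ : 2 ≤ k * (t₂ - t₁)) :
    k / 4 * Real.exp (k * (t₂ - t₁)) ≤ w₀ ∧ d α ≤ ((t₁ - α) + 2 / k) * w₀ ∧
      g β ≤ ((β - t₂) + 2 / k) * w₀ ∧ ∀ x ∈ Icc t₁ t₂, g x * d x ≤ 4 / k * w₀ := by
  have hg1 : ∀ x ∈ Icc α β, 1 ≤ g x := fun x hx ↦ (hsign x hx).1
  have hg'0 : ∀ x ∈ Icc α β, 0 ≤ g' x := fun x hx ↦ (hsign x hx).2.1
  have hw₀ : 0 ≤ w₀ := by rw [← hg'β]; exact hg'0 β (right_mem_Icc.2 (hαt.trans (ht.le.trans htβ)))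
  have hℓ : 0 < t₂ - t₁ := sub_pos.2 ht
  -- depth
  have hdepth : k / 4 * Real.exp (k * (t₂ - t₁)) ≤ w₀ := by
    have h1 := depth_of_good_interval hg hq0 hg1 hg'0 hαt ht htβ hk hqk
    rw [hg'β] at h1
    -- `e^y ≤ 4 sinh y` for `y ≥ 1` (cf. the tree's `exp_le_four_mul_sinh` in unrelated topics)
    have h2 : Real.exp (k * (t₂ - t₁)) ≤ 4 * Real.sinh (k * (t₂ - t₁)) := by
      set y := k * (t₂ - t₁) with hy
      have hy1 : 1 ≤ y := by linarith
      rw [Real.sinh_eq]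
      have e1 : 2 ≤ Real.exp y := by linarith [Real.add_one_le_exp y]
      have e2 : Real.exp (-y) ≤ 1 / 2 := by
        rw [Real.exp_neg, inv_le_comm₀ (Real.exp_pos y) (by norm_num : (0:ℝ) < 1 / 2)]
        linarith
      linarith
    calc k / 4 * Real.exp (k * (t₂ - t₁)) ≤ k / 4 * (4 * Real.sinh (k * (t₂ - t₁))) :=
          mul_le_mul_of_nonneg_left h2 (by positivity)
      _ = k * Real.sinh (k * (t₂ - t₁)) := by ring
      _ ≤ w₀ := h1
  -- the rates from `barrierBasis_rates`, with `1/(k tanh) ≤ 2/k`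
  obtain ⟨hRα, hRβ, hRm⟩ := barrierBasis_rates hg hd hq0 hg'α hg'β hsign hW hgα hαt ht htβ hk hqk
  obtain ⟨-, hinv⟩ := tanh_rate_pos_and_inv_le hk hℓ
  have hinv' : 1 / (k * Real.tanh (k * (t₂ - t₁))) ≤ 2 / k := hinv (by linarith)
  refine ⟨hdepth, ?_, ?_, fun x hx ↦ ?_⟩
  · exact hRα.trans (mul_le_mul_of_nonneg_right (by linarith) hw₀)
  · exact hRβ.trans (mul_le_mul_of_nonneg_right (by linarith) hw₀)
  · -- one of the two halves has length `≥ (t₂ − t₁)/2 ≥ 1/k`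
    rcases le_or_gt ((t₂ - t₁) / 2) (x - t₁) with h | h
    · have hx1 : t₁ < x := by linarith
      have hx2 : x < t₂ ∨ x = t₂ := lt_or_eq_of_le hx.2
      rcases hx2 with hx2 | hx2
      · have key := (hRm x ⟨hx1, hx2⟩).1
        obtain ⟨hpos, hinvx⟩ := tanh_rate_pos_and_inv_le hk (sub_pos.2 hx1)
        have hx3 : 1 / (k * Real.tanh (k * (x - t₁))) ≤ 2 / k := hinvx (by nlinarith)
        calc g x * d x ≤ w₀ / (k * Real.tanh (k * (x - t₁))) := key
          _ = 1 / (k * Real.tanh (k * (x - t₁))) * w₀ := by ring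
          _ ≤ 2 / k * w₀ := mul_le_mul_of_nonneg_right hx3 hw₀
          _ ≤ 4 / k * w₀ := by
              apply mul_le_mul_of_nonneg_right _ hw₀
              exact div_le_div_of_nonneg_right (by norm_num) hk.le
      · -- `x = t₂`: the left lemma on `[t₁, t₂]`
        rw [hx2]
        -- `g d ≤ w₀/(k tanh(k(t₂ − t₁)))` by the left lemma applied on `[t₁, t₂]`
        have hxI : t₂ ∈ Icc α β := ⟨hαt.trans ht.le, htβ⟩
        have hWx : g' t₂ * d t₂ - g t₂ * d' t₂ = w₀ := by linarith [hW t₂ hxI]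
        have hsubL : Icc t₁ t₂ ⊆ Icc α β := Icc_subset_Icc hαt htβ
        have key := mul_le_wronskian_div_of_left (fun s hs ↦ hg s (hsubL hs)) hqk
          (fun s hs ↦ zero_le_one.trans (hg1 s (hsubL hs))) (hg'0 t₁ ⟨hαt, ht.le.trans htβ⟩) hk ht
          (zero_le_one.trans (hsign t₂ hxI).2.2.1) (hsign t₂ hxI).2.2.2 hWx
        calc g t₂ * d t₂ ≤ w₀ / (k * Real.tanh (k * (t₂ - t₁))) := key
          _ = 1 / (k * Real.tanh (k * (t₂ - t₁))) * w₀ := by ring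
          _ ≤ 2 / k * w₀ := mul_le_mul_of_nonneg_right hinv' hw₀
          _ ≤ 4 / k * w₀ := by
              apply mul_le_mul_of_nonneg_right _ hw₀
              exact div_le_div_of_nonneg_right (by norm_num) hk.le
    · have hx2 : x < t₂ := by linarith [hx.2]
      have hx1 : t₁ < x ∨ t₁ = x := lt_or_eq_of_le hx.1
      rcases hx1 with hx1 | hx1
      · have key := (hRm x ⟨hx1, hx2⟩).2
        obtain ⟨hpos, hinvx⟩ := tanh_rate_pos_and_inv_le hk (sub_pos.2 hx2)
        have hx3 : 1 / (k * Real.tanh (k * (t₂ - x))) ≤ 2 / k := hinvx (by nlinarith)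
        calc g x * d x ≤ w₀ / (k * Real.tanh (k * (t₂ - x))) := key
          _ = 1 / (k * Real.tanh (k * (t₂ - x))) * w₀ := by ring
          _ ≤ 2 / k * w₀ := mul_le_mul_of_nonneg_right hx3 hw₀
          _ ≤ 4 / k * w₀ := by
              apply mul_le_mul_of_nonneg_right _ hw₀
              exact div_le_div_of_nonneg_right (by norm_num) hk.le
      · rw [← hx1]
        have hxI : t₁ ∈ Icc α β := ⟨hαt, ht.le.trans htβ⟩
        have hWx : g' t₁ * d t₁ - g t₁ * d' t₁ = w₀ := by linarith [hW t₁ hxI]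
        have hsubR : Icc t₁ t₂ ⊆ Icc α β := Icc_subset_Icc hαt htβ
        have key := mul_le_wronskian_div_of_right (fun s hs ↦ hd s (hsubR hs)) hqk
          (fun s hs ↦ zero_le_one.trans (hsign s (hsubR hs)).2.2.1)
          (hsign t₂ ⟨hαt.trans ht.le, htβ⟩).2.2.2 hk ht (zero_le_one.trans (hg1 t₁ hxI)) (hg'0 t₁ hxI)
          hWx
        calc g t₁ * d t₁ ≤ w₀ / (k * Real.tanh (k * (t₂ - t₁))) := key
          _ = 1 / (k * Real.tanh (k * (t₂ - t₁))) * w₀ := by ring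
          _ ≤ 2 / k * w₀ := mul_le_mul_of_nonneg_right hinv' hw₀
          _ ≤ 4 / k * w₀ := by
              apply mul_le_mul_of_nonneg_right _ hw₀
              exact div_le_div_of_nonneg_right (by norm_num) hk.le

end Literature.Analysis.ODE

end
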